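import Literature.Probability.LatticeModels.MeshDomainBigComponents
import Literature.Probability.LatticeModels.MeshApproximatesPolyomino
import HarnessLib

/-!
# Lattice uniform local connectivity of a Jordan domain at a boundary point — assembly
(line `symplectic-fermion-anchor`, crux `SAWLoopFugacityFlow.AvoidanceLimit`, stmt-CriticalPhenomena-10649; lead c4)

`latticeLocalConnectivity_of`: for a Jordan domain `D`, a boundary point `p` and `ρ > 0` there is `r > 0`
such that, for all small meshes `δ`, any two vertices of `Ω_δ = meshDomain D δ` within `r` of `p` are joined
by an `Ω_δ`-walk staying within `ρ` of `p` — GIVEN (as hypotheses, each landed separately)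
(T-c) a local Jordan neighbourhood `N ⊆ D ∩ B(p,ρ) ⊇ D ∩ B(p,r)` of `p` with the separation property, and
(T-e) the transfer of mesh walks of a Jordan sub-domain to `Ω_δ(D)`-walks.
Tree inputs: the macroscopic-diameter criterion `JordanDomain.exists_mem_meshDomain_of_reachable`
(mesh components of diameter `≥ L` are the bulk) and the bulk theorem
`JordanDomain.exists_forall_mem_meshDomain_and_reachable` (the bulk is one component), both for `N` and `D`.
Argument: an `Ω_δ(D)`-walk from `u` to `v`; either it is a mesh walk of `N` (done), or its first non-`N` step
issues from a vertex `w` of `u`'s `N`-component within `δ` of a point of `(D ∖ N) ∪ (D̄ ∖ N̄)`, which by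
separation is at distance `≥ L` from `u`; so `u`'s `N`-component is macroscopic, hence the bulk of `N`; same
for `v`; and the bulk of `N` is connected. Folklore; no definitions.
-/

noncomputable section

open scoped Topology
open Filter Set Metric
open Literature.Probability.RandomPlanarGeometry Literature.Probability.LatticeModels

namespace Summit.CriticalPhenomena.SAWScalingLimit.Theorems.AvoidanceLimit.Anchor

/-- Vertices of an `Ω_δ`-walk issued from a vertex of `Ω_δ` all lie in `Ω_δ`. [folklore] -/
theorem forall_mem_meshDomain_of_walk {Ω : Set ℂ} {δ : ℝ} {u v : Site 2}
    (π : (discreteDomainGraph Ω δ).Walk u v) (hu : u ∈ meshDomain Ω δ) :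
    ∀ z ∈ π.support, z ∈ meshDomain Ω δ := by
  induction π with
  | nil => intro z hz; rw [SimpleGraph.Walk.support_nil, List.mem_singleton] at hz; subst hz; exact hu
  | cons h π ih =>
    intro z hz
    rw [SimpleGraph.Walk.support_cons, List.mem_cons] at hz
    rcases hz with rfl | hz
    · exact hu
    · exact ih (discreteDomainGraph_adj_iff.1 h).2.2 z hz

/-- **The prefix alternative.** Let `N, D` be sets and let `π` be an `Ω_δ(D)`-walk from `u ∈ Ω_δ(D)`
with `δu ∈ N`. Either `π` is a mesh walk of `N` (all its mesh points lie in `N` and its endpoints are joined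
in the mesh graph of `N`), or some vertex `w` of `u`'s `N`-mesh component is within `δ` of a point `c` of
`closure D` lying in `(D ∖ N) ∪ (closure D ∖ closure N)` (the first step of `π` leaving the mesh graph of
`N`). [folklore] -/
theorem prefix_alternative {D N : Set ℂ} {δ : ℝ} (hδ : 0 ≤ δ) {u v : Site 2}
    (π : (discreteDomainGraph D δ).Walk u v) (hu : u ∈ meshDomain D δ) (huN : meshPoint δ u ∈ N) :
    ((∀ z ∈ π.support, meshPoint δ z ∈ N) ∧
        ∃ (hu' : u ∈ meshVertices N δ) (hv' : v ∈ meshVertices N δ),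
          (meshVertexGraph N δ).Reachable ⟨u, hu'⟩ ⟨v, hv'⟩) ∨
      ∃ w : Site 2, (∃ (hu' : u ∈ meshVertices N δ) (hw' : w ∈ meshVertices N δ),
          (meshVertexGraph N δ).Reachable ⟨u, hu'⟩ ⟨w, hw'⟩) ∧
        ∃ c ∈ closure D, ((c ∈ D ∧ c ∉ N) ∨ c ∉ closure N) ∧ dist (meshPoint δ w) c ≤ δ := by
  induction π with
  | nil =>
    exact Or.inl ⟨fun z hz => by
      rw [SimpleGraph.Walk.support_nil, List.mem_singleton] at hz; subst hz; exact huN,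
      huN, huN, SimpleGraph.Reachable.refl _⟩
  | @cons a b c h π ih =>
    -- `a = u`; the first step `a → b`
    obtain ⟨hab, haM, hbM⟩ := discreteDomainGraph_adj_iff.1 h
    obtain ⟨hzd, hseg⟩ := meshGraph_adj_iff.1 hab
    have hbD : meshPoint δ b ∈ D := meshDomain_subset_meshVertices D δ hbM
    by_cases hbN : meshPoint δ b ∈ N
    · by_cases hsegN : segment ℝ (meshPoint δ a) (meshPoint δ b) ⊆ closure N
      · -- the step is a mesh step of `N`: recurse
        have hadjN : (meshVertexGraph N δ).Adj ⟨a, huN⟩ ⟨b, hbN⟩ := by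
          show (meshGraph N δ).Adj a b
          exact meshGraph_adj_iff.2 ⟨hzd, hsegN⟩
        rcases ih hbM hbN with ⟨hall, hb', hv', hreach⟩ | ⟨w, ⟨hb', hw', hreach⟩, hc⟩
        · refine Or.inl ⟨fun z hz => ?_, huN, hv', ?_⟩
          · rw [SimpleGraph.Walk.support_cons, List.mem_cons] at hz
            rcases hz with rfl | hz
            · exact huN
            · exact hall z hz
          · have e : (⟨b, hbN⟩ : meshVertices N δ) = ⟨b, hb'⟩ := rfl
            exact hadjN.reachable.trans (e ▸ hreach)
        · refine Or.inr ⟨w, ⟨huN, hw', ?_⟩, hc⟩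
          have e : (⟨b, hbN⟩ : meshVertices N δ) = ⟨b, hb'⟩ := rfl
          exact hadjN.reachable.trans (e ▸ hreach)
      · -- the segment leaves `closure N`: a witness `c` on it
        obtain ⟨c', hc'seg, hc'N⟩ := not_subset.1 hsegN
        refine Or.inr ⟨a, ⟨huN, huN, SimpleGraph.Reachable.refl _⟩, c', hseg hc'seg, Or.inr hc'N, ?_⟩
        have hsub : segment ℝ (meshPoint δ a) (meshPoint δ b) ⊆
            closedBall (meshPoint δ a) (dist (meshPoint δ a) (meshPoint δ b)) :=
          (convex_closedBall _ _).segment_subset (mem_closedBall_self dist_nonneg)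
            (by rw [mem_closedBall, dist_comm])
        have h1 : dist (meshPoint δ a) c' ≤ dist (meshPoint δ a) (meshPoint δ b) := by
          have := hsub hc'seg
          rwa [mem_closedBall, dist_comm] at this
        exact h1.trans (Polyomino.dist_meshPoint_le_of_adj hδ hzd)
    · -- the next vertex is outside `N`
      refine Or.inr ⟨a, ⟨huN, huN, SimpleGraph.Reachable.refl _⟩, meshPoint δ b,
        subset_closure hbD, Or.inl ⟨hbD, hbN⟩, Polyomino.dist_meshPoint_le_of_adj hδ hzd⟩

/-- **(T) from (T-c) and (T-e).** Lattice uniform local connectivity of `Ω_δ(D)` at a boundary point of a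
Jordan domain, from the local Jordan neighbourhood with separation (`hTc`) and the walk transfer (`hTe`).
[folklore] -/
theorem latticeLocalConnectivity_of :
    (∀ (D : JordanDomain) (p : ℂ), p ∈ frontier D.carrier → ∀ ρ : ℝ, 0 < ρ →
      ∃ (N : JordanDomain) (r m L : ℝ), 0 < r ∧ 0 < m ∧ 0 < L ∧
        N.carrier ⊆ D.carrier ∧ N.carrier ⊆ Metric.ball p ρ ∧
        (∀ z ∈ D.carrier, dist z p < r → z ∈ N.carrier) ∧
        (∀ a ∈ N.carrier, ∀ c ∈ closure D.carrier,
          (c ∈ D.carrier ∧ c ∉ N.carrier) ∨ c ∉ closure N.carrier → dist a c < m →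
          ∀ z ∈ D.carrier, dist z p < r → L ≤ dist z a)) →
    (∀ (D N : JordanDomain) (δ : ℝ), 0 < δ → N.carrier ⊆ D.carrier →
      ∀ (x y : ↥(meshVertices N.carrier δ)), (meshVertexGraph N.carrier δ).Reachable x y →
        (x : Site 2) ∈ meshDomain D.carrier δ →
        ∃ w : (discreteDomainGraph D.carrier δ).Walk (x : Site 2) (y : Site 2),
          ∀ z ∈ w.support, meshPoint δ z ∈ N.carrier ∧ z ∈ meshDomain D.carrier δ) →
    ∀ (D : JordanDomain) (p : ℂ), p ∈ frontier D.carrier → ∀ ρ : ℝ, 0 < ρ → ∃ r : ℝ, 0 < r ∧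
      ∀ᶠ δ in 𝓝[>] (0 : ℝ), ∀ u v : Site 2, u ∈ meshDomain D.carrier δ → v ∈ meshDomain D.carrier δ →
        dist (meshPoint δ u) p < r → dist (meshPoint δ v) p < r →
        ∃ w : (discreteDomainGraph D.carrier δ).Walk u v,
          ∀ z ∈ w.support, z ∈ meshDomain D.carrier δ ∧ dist (meshPoint δ z) p < ρ := by
  intro hTc hTe D p hp ρ hρ
  obtain ⟨N, r, m, L, hr, hm, hL, hND, hNball, hrN, hsep⟩ := hTc D p hp ρ hρ
  refine ⟨r, hr, ?_⟩
  -- eventually: bulk connectivity of `D` and of `N`, the macroscopic criterion for `N`, `0 < δ < m`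
  obtain ⟨δD, hδD, hbulkD⟩ := D.exists_forall_mem_meshDomain_and_reachable isCompact_empty (empty_subset _)
  obtain ⟨δN, hδN, hbulkN⟩ := N.exists_forall_mem_meshDomain_and_reachable isCompact_empty (empty_subset _)
  obtain ⟨δL, hδL, hmacro⟩ := N.exists_mem_meshDomain_of_reachable hL
  have hsmall : ∀ᶠ δ in 𝓝[>] (0 : ℝ), δ ∈ Ioo (0 : ℝ) (min (min δD δN) (min δL m)) :=
    Ioo_mem_nhdsGT (lt_min (lt_min hδD hδN) (lt_min hδL hm))
  filter_upwards [hsmall] with δ hδ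
  obtain ⟨hδ0, hδlt⟩ := hδ
  have hδD' : δ < δD := hδlt.trans_le ((min_le_left _ _).trans (min_le_left _ _))
  have hδN' : δ < δN := hδlt.trans_le ((min_le_left _ _).trans (min_le_right _ _))
  have hδL' : δ < δL := hδlt.trans_le ((min_le_right _ _).trans (min_le_left _ _))
  have hδm : δ < m := hδlt.trans_le ((min_le_right _ _).trans (min_le_right _ _))
  intro u v hu hv hur hvr
  -- the conclusion from a joining walk inside `N`
  have conclude : ∀ (hu' : u ∈ meshVertices N.carrier δ) (hv' : v ∈ meshVertices N.carrier δ),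
      (meshVertexGraph N.carrier δ).Reachable ⟨u, hu'⟩ ⟨v, hv'⟩ →
      ∃ w : (discreteDomainGraph D.carrier δ).Walk u v,
        ∀ z ∈ w.support, z ∈ meshDomain D.carrier δ ∧ dist (meshPoint δ z) p < ρ := by
    intro hu' hv' hreach
    obtain ⟨w, hw⟩ := hTe D N δ hδ0 hND ⟨u, hu'⟩ ⟨v, hv'⟩ hreach hu
    exact ⟨w, fun z hz => ⟨(hw z hz).2, mem_ball.1 (hNball (hw z hz).1)⟩⟩
  -- mesh points of `u`, `v` lie in `N`
  have huD : meshPoint δ u ∈ D.carrier := meshDomain_subset_meshVertices _ _ hu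
  have hvD : meshPoint δ v ∈ D.carrier := meshDomain_subset_meshVertices _ _ hv
  have huN : meshPoint δ u ∈ N.carrier := hrN _ huD hur
  have hvN : meshPoint δ v ∈ N.carrier := hrN _ hvD hvr
  -- an `Ω_δ(D)`-walk from `u` to `v` (the bulk of `D` is connected; transfer with `N := D`)
  obtain ⟨hu'', hv'', hreachD⟩ := (hbulkD δ hδ0 hδD').2 u hu v hv
  obtain ⟨π, -⟩ := hTe D D δ hδ0 subset_rfl ⟨u, hu''⟩ ⟨v, hv''⟩ hreachD hu
  -- the macroscopic alternative at one endpoint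
  have big : ∀ {a b : Site 2} (θ : (discreteDomainGraph D.carrier δ).Walk a b), a ∈ meshDomain D.carrier δ →
      meshPoint δ a ∈ N.carrier → dist (meshPoint δ a) p < r →
      ((∀ z ∈ θ.support, meshPoint δ z ∈ N.carrier) ∧
          ∃ (ha' : a ∈ meshVertices N.carrier δ) (hb' : b ∈ meshVertices N.carrier δ),
            (meshVertexGraph N.carrier δ).Reachable ⟨a, ha'⟩ ⟨b, hb'⟩) ∨
        a ∈ meshDomain N.carrier δ := by
    intro a b θ ha haN har
    rcases prefix_alternative hδ0.le θ ha haN with hA | ⟨w, ⟨ha', hw', hreach⟩, c, hcD, hc, hdist⟩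
    · exact Or.inl hA
    · right
      have hfar : L ≤ dist (meshPoint δ a) (meshPoint δ w) :=
        hsep (meshPoint δ w) hw' c hcD hc (hdist.trans_lt hδm) (meshPoint δ a) (hND haN |> fun _ => ?_) har
      · exact hmacro δ hδ0 hδL' ⟨a, ha'⟩ ⟨w, hw'⟩ hreach hfar
      · exact meshDomain_subset_meshVertices _ _ ha
  rcases big π hu huN hur with ⟨-, hu', hv', hreach⟩ | huB
  · exact conclude hu' hv' hreach
  rcases big π.reverse (forall_mem_meshDomain_of_walk π hu v π.end_mem_support) hvN hvr with
    ⟨-, hv', hu', hreach⟩ | hvB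
  · exact conclude hu' hv' hreach.symm
  -- both endpoints in the bulk of `N`, which is connected
  obtain ⟨hu', hv', hreach⟩ := (hbulkN δ hδ0 hδN').2 u huB v hvB
  exact conclude hu' hv' hreach

end Summit.CriticalPhenomena.SAWScalingLimit.Theorems.AvoidanceLimit.Anchor

end
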